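import Literature.Analysis.FluidPDE.TorusNSChessboardTimeAverages
import Literature.Analysis.FluidPDE.TorusNSFoiasGuillopeTemamH3
import Literature.Analysis.FunctionSpaces.TorusConvectionGradLaplacianNormSq
import HarnessLib

/-!
# Gibbon's chessboard on `T³` through the `H³` rung: row `n = 1` for `3 < m < ∞`
# (`∫₀ᵀ ‖∇u‖_{2m}^{2m/(4m−3)}`, `∫₀ᵀ ‖ω‖_{2m}^{2m/(4m−3)}`) and row `n = 2` for `1 < m < 3`
# (`∫₀ᵀ ‖∇²u‖_{2m}^{2m/(6m−3)}`), bounded a priori for classical Navier–Stokes solutions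

Analysis/FluidPDE proof file (theorems only; no definitions, no named facts).

Search for candidate a priori estimates; no regularity claim. Sequel of
`TorusNSChessboardTimeAverages.lean` (row `n = 1` for `1 < m ≤ 3` and row `n = 0`, from the
`H¹`–`H²` budgets only) and `TorusNSFoiasGuillopeTemamH3.lean` (the `H³` rung
`ν∫₀ᵀ‖∇Δu‖₂²/(1+‖Δu‖₂²)^{4/3} ≤ W₃` and the square `(1, ∞)`). With the `H³` budget the squares of
Gibbon's chessboard (J. Nonlinear Sci. 29 (2019), Thm 2 (i), Appendix A §5.1) that interpolate
between `H¹, H², H³` follow exactly as printed, here for classical solutions with mean-zero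
slices on `[0, T] × T^d`, `card d = 3`, with `E = ‖u(0)‖₂²/(2ν)`, `Y₁ = 1/ν + 27‖u(0)‖₂²/(8π⁴ν⁵)`,
`B₂ = Y₁^{1/3}(T+E)^{2/3}`, `W₃ = 3 + (3/2)(3√2/π)^{4/3}(2ν)^{−1/3}B₂` and the only inexplicit
factors the tree's Sobolev constants:

* Row `n = 1`, `3 < m < ∞` (Appendix A §5.1 with `N = 2`; sup × `L⁶` with the explicit gradient
  Agmon inequality `|∇v|² ≤ (2/π²)‖Δv‖₂‖∇Δv‖₂`): `Torus.integral_gradSq_rpow_le_of_cube_le_high`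
  ((A.2): `∫|∇v|^{2m} ≤ C₆(2/π²)^{m−3}‖Δv‖₂^{m+3}‖∇Δv‖₂^{m−3}`),
  `Torus.exists_classicalNS_integral_gradSq_rpow_le_high`
  (`∫₀ᵀ(∫|∇u|^{2m})^{1/(4m−3)} ≤ K (W₃/ν)^{(m−3)/(2(4m−3))}(T+B₂)^{(7m−3)/(2(4m−3))}`), and the
  vorticity form `Torus.exists_classicalNS_integral_vorticitySq_rpow_le_high` (Gibbon's `⟨D_m⟩_T`).
  With `TorusNSChessboardTimeAverages` (`1 < m ≤ 3`) and
  `Torus.classicalNS_integral_gradientAgmonMajorant_le` (`m = ∞`) this completes row `n = 1`.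
* Row `n = 2`, `1 < m < 3` (`L²`–`L⁶` interpolation of the Hessian against the `H³` rung):
  `Torus.exists_integral_hessSq_cube_le_gradNormSq_laplacian_cube` (Sobolev for the Hessian,
  `∫(∑ⱼᵢ‖∂ᵢ∂ⱼv‖²)³ ≤ C‖∇Δv‖₂⁶`), `Torus.integral_hessSq_rpow_le_of_cube_le` ((A.2) for `n = 2`),
  `Torus.exists_classicalNS_integral_hessSq_rpow_le`
  (`∫₀ᵀ(∫|∇²u|^{2m})^{1/(6m−3)} ≤ K (W₃/ν)^{(m−1)/(2(2m−1))}(T+B₂)^{(3m−1)/(2(2m−1))}`,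
  `|∇²u|² = ∑ⱼ∑ᵢ‖∂ᵢ∂ⱼu‖²`, `∫|∇²u|² = ‖Δu‖₂²`).

Scope (faithfulness): unforced classical solutions with mean-zero slices on `[0, T] × T³` in place
of Leray–Hopf weak solutions of the forced equations; bounds written out instead of
`c_{n,m} Re³ + O(T⁻¹)`. Not covered: `(2, m)` for `m ≥ 3` and rows `n ≥ 3` beyond `(3, 1)` (they
need the `H⁴` rung, i.e. the Doering–Gibbon ladder for `N = 3`).

## Mathlib / tree search

Tree (used): `Torus.sum_norm_sq_partialDeriv_le_agmon_explicit` (`TorusPalinstrophyLadder`),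
`Torus.exists_integral_gradSq_cube_le_laplacianSq_cube` (`TorusNSSerrinCriterion`),
`Torus.exists_integral_norm_pow_six_le_gradNormSq_cube`, `Torus.integral_rpow_le_interpolate_two_six'`
(`TorusNSChessboardTimeAverages`, `TorusNSBeiraoDaVeigaCriterion`),
`Torus.gradNormSq_partialDeriv_partialDeriv_le` (`TorusConvectionGradLaplacianNormSq`),
`Torus.integral_sum_sum_norm_partialDeriv_partialDeriv_sq_eq` (`TorusConvectionGradNormSq`),
`Torus.classicalNS_integral_gradNormSq_laplacian_div_le` (`TorusNSFoiasGuillopeTemamH3`),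
`Torus.classicalNS_integral_laplacian_twoThirds_le`; Mathlib `integral_mul_le_Lp_mul_Lq_of_nonneg`,
`pow_sum_le_card_mul_sum_pow`, `Real.rpow_add_le_add_rpow`.
Searched: `hessSq|gradSq_rpow.*high|chessboard` — only the parent files.

## References

* [Gibbon2019Chessboard] J. D. Gibbon, J. Nonlinear Sci. 29 (2019) 215–228, Thm 2 (i),
  Appendix A §5.1 (held: arXiv:1803.11518 pp. 4–7).
* [FoiasGuillopeTemam1981] Comm. PDE 6 (1981) 329–359, Thm 3.1 (the `H^m` budgets).
* [RobinsonRodrigoSadowskiCUP2016] Thm 1.18 (`H¹ ⊂ L⁶` on `T³`).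
-/

noncomputable section

open Set MeasureTheory intervalIntegral Filter Real
open scoped InnerProductSpace RealInnerProductSpace Topology ENNReal

namespace Literature.Analysis.FluidPDE

open Literature.Analysis.FunctionSpaces

variable {d : Type*} [Fintype d] [DecidableEq d]

/-! ### Continuity in time (tube lemma) -/

omit [DecidableEq d] in
/-- Space integrals of fields with continuous space–time lift and continuous slices depend
continuously on time. [folklore] -/
private theorem continuousOn_integral_of_continuousOn_stLift'' {S : Set ℝ}
    {φ : ℝ → UnitAddTorus d → ℝ} (hφ : ContinuousOn (Torus.stLift φ) (S ×ˢ univ))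
    (hsl : ∀ t ∈ S, Continuous (φ t)) : ContinuousOn (fun t => ∫ x, φ t x) S := by
  intro t ht
  rw [ContinuousWithinAt, Metric.tendsto_nhds]
  intro ε hε
  have h := Torus.eventually_norm_sub_lt_of_continuousOn hφ ht (half_pos hε)
  filter_upwards [h, self_mem_nhdsWithin] with s hs hsS
  have his : Integrable (φ s) := (hsl s hsS).integrable_unitAddTorus
  have hit : Integrable (φ t) := (hsl t ht).integrable_unitAddTorus
  rw [Real.dist_eq, ← integral_sub his hit]
  calc |∫ x, (φ s x - φ t x)| ≤ ∫ x, |φ s x - φ t x| := abs_integral_le_integral_abs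
    _ ≤ ∫ _x : UnitAddTorus d, ε / 2 := by
        refine integral_mono_of_nonneg (ae_of_all _ fun x => abs_nonneg _) (integrable_const _)
          (ae_of_all _ fun x => ?_)
        have h1 := hs x
        rw [Real.norm_eq_abs] at h1
        exact h1.le
    _ = ε / 2 := by simp
    _ < ε := half_lt_self hε

/-- `t ↦ ∫ (∑ⱼ‖∂ⱼu(t)‖²)^m`, `t ↦ ∫ |ω(t)|^{2m}`, `t ↦ ‖Δu(t)‖₂²`, `t ↦ ‖∇Δu(t)‖₂²` are continuous on
`[a, b]` along a classical solution (`0 ≤ m`). [folklore] -/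
private theorem continuousOn_four {ν a b : ℝ} (hab : a < b)
    {f u : ℝ → UnitAddTorus d → EuclideanSpace ℝ d} {p : ℝ → UnitAddTorus d → ℝ}
    (h : Torus.IsClassicalNSSolutionOn (Icc a b) ν f u p) {m : ℝ} (hm : 0 ≤ m) :
    ContinuousOn (fun t => ∫ x, (∑ j, ‖Torus.partialDeriv j (u t) x‖ ^ 2) ^ m) (Icc a b) ∧
    ContinuousOn (fun t => ∫ x, torusVorticitySqAt (u t) x ^ m) (Icc a b) ∧
    ContinuousOn (fun t => ∫ x, ‖Torus.laplacian (u t) x‖ ^ 2) (Icc a b) ∧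
    ContinuousOn (fun t => Torus.gradNormSq (Torus.laplacian (u t))) (Icc a b) := by
  have hU : UniqueDiffOn ℝ (Icc a b) := uniqueDiffOn_Icc hab
  have hst : ∀ j, ContinuousOn (Torus.stLift fun t => Torus.partialDeriv j (u t)) (Icc a b ×ˢ univ) :=
    fun j => (h.smooth_velocity.partialDeriv hU j).continuousOn_stLift
  have hstc : ∀ i j, ContinuousOn (fun q => Torus.stLift (fun t => Torus.partialDeriv i (u t)) q j)
      (Icc a b ×ˢ univ) :=
    fun i j => (EuclideanSpace.proj j).continuous.comp_continuousOn (hst i)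
  have hΔ := h.smooth_velocity.laplacian hU
  have hst3 : ∀ i, ContinuousOn
      (Torus.stLift fun t => Torus.partialDeriv i (Torus.laplacian (u t))) (Icc a b ×ˢ univ) :=
    fun i => (hΔ.partialDeriv hU i).continuousOn_stLift
  refine ⟨?_, ?_, ?_, ?_⟩
  · refine continuousOn_integral_of_continuousOn_stLift'' ?_ fun t ht => ?_
    · have e : Torus.stLift (fun t x => (∑ j, ‖Torus.partialDeriv j (u t) x‖ ^ 2) ^ m) =
          fun q => (∑ j, ‖Torus.stLift (fun t => Torus.partialDeriv j (u t)) q‖ ^ 2) ^ m := rfl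
      rw [e]
      exact (continuousOn_finsetSum _ fun j _ => ((hst j).norm).pow 2).rpow_const
        fun q _ => Or.inr hm
    · have hut : Torus.IsSmooth (u t) := h.smooth_velocity.isSmooth_slice ht
      exact (continuous_finsetSum _ fun j _ =>
        (((hut.partialDeriv j).continuous).norm).pow 2).rpow_const fun x => Or.inr hm
  · refine continuousOn_integral_of_continuousOn_stLift'' ?_ fun t ht => ?_
    · have e : Torus.stLift (fun t x => torusVorticitySqAt (u t) x ^ m) =
          fun q => (2⁻¹ * ∑ i, ∑ j, (Torus.stLift (fun t => Torus.partialDeriv i (u t)) q j -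
            Torus.stLift (fun t => Torus.partialDeriv j (u t)) q i) ^ 2) ^ m := rfl
      rw [e]
      refine ContinuousOn.rpow_const ?_ fun q _ => Or.inr hm
      exact continuousOn_const.mul (continuousOn_finsetSum _ fun i _ =>
        continuousOn_finsetSum _ fun j _ => ((hstc i j).sub (hstc j i)).pow 2)
    · have hut : Torus.IsSmooth (u t) := h.smooth_velocity.isSmooth_slice ht
      have hc : ∀ i j, Continuous fun x => Torus.partialDeriv i (u t) x j :=
        fun i j => (EuclideanSpace.proj j).continuous.comp (hut.partialDeriv i).continuous
      refine Continuous.rpow_const ?_ fun x => Or.inr hm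
      exact continuous_const.mul (continuous_finsetSum _ fun i _ =>
        continuous_finsetSum _ fun j _ => ((hc i j).sub (hc j i)).pow 2)
  · intro t ht
    have h1 : ContinuousWithinAt
        (fun s => (2 : ℝ) * (2⁻¹ * ∫ x, ‖Torus.laplacian (u s) x‖ ^ 2)) (Icc a b) t :=
      continuousWithinAt_const.mul
        (h.hasDerivWithinAt_half_integral_norm_laplacian_sq hab ht).continuousWithinAt
    refine h1.congr (fun s _ => ?_) ?_ <;> ring
  · unfold Torus.gradNormSq
    refine continuousOn_integral_of_continuousOn_stLift'' ?_ fun t ht => ?_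
    · have e : Torus.stLift (fun t x => ∑ i, ‖Torus.partialDeriv i (Torus.laplacian (u t)) x‖ ^ 2) =
          fun q => ∑ i, ‖Torus.stLift (fun t => Torus.partialDeriv i (Torus.laplacian (u t))) q‖ ^ 2 :=
        rfl
      rw [e]
      exact continuousOn_finsetSum _ fun i _ => ((hst3 i).norm).pow 2
    · have hut : Torus.IsSmooth (u t) := h.smooth_velocity.isSmooth_slice ht
      exact continuous_finsetSum _ fun i _ =>
        (((hut.laplacian.partialDeriv i).continuous).norm).pow 2

/-! ### (A.2) with `N = 2`, `3 < m`: sup × `L⁶` for the gradient -/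

/-- **Gibbon (A.2) with `n = 1`, `N = 2`, `3 < m`** (`‖∇v‖_{2m} ≤ C‖∇³v‖₂^a‖∇v‖₂^{1−a}` family),
here in the form obtained from sup × `L⁶` on `T^d`, `card d = 3`: for a smooth `v` with the
Sobolev bound `∫|∇v|⁶ ≤ C(∫‖Δv‖²)³`,
`∫ |∇v|^{2m} ≤ C (2/π²)^{m−3} (∫‖Δv‖²)^{(m+3)/2} (‖∇Δv‖₂²)^{(m−3)/2}`, `|∇v|² = ∑ⱼ‖∂ⱼv‖²`
(pointwise `|∇v|² ≤ (2/π²)‖Δv‖₂‖∇Δv‖₂`, `Torus.sum_norm_sq_partialDeriv_le_agmon_explicit`).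
[cite: Gibbon2019Chessboard, Appendix A §5.1 eq. (A.2) (n = 1, N = 2)] -/
theorem Torus.integral_gradSq_rpow_le_of_cube_le_high (hd : Fintype.card d = 3) {m : ℝ}
    (hm : 3 < m) {v : UnitAddTorus d → EuclideanSpace ℝ d} (hv : Torus.IsSmooth v) {C : ℝ}
    (hC : ∫ x, (∑ j, ‖Torus.partialDeriv j v x‖ ^ 2) ^ 3 ≤
      C * (∫ x, ‖Torus.laplacian v x‖ ^ 2) ^ 3) :
    ∫ x, (∑ j, ‖Torus.partialDeriv j v x‖ ^ 2) ^ m ≤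
      C * (2 / π ^ 2) ^ (m - 3) * (∫ x, ‖Torus.laplacian v x‖ ^ 2) ^ ((m + 3) / 2) *
        Torus.gradNormSq (Torus.laplacian v) ^ ((m - 3) / 2) := by
  have hπ : 0 < π := Real.pi_pos
  set P : ℝ := ∫ x, ‖Torus.laplacian v x‖ ^ 2 with hPdef
  set D : ℝ := Torus.gradNormSq (Torus.laplacian v) with hDdef
  have hP0 : 0 ≤ P := integral_nonneg fun x => sq_nonneg _
  have hD0 : 0 ≤ D := Torus.gradNormSq_nonneg _
  have hc0 : (0 : ℝ) ≤ 2 / π ^ 2 := by positivity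
  set F : UnitAddTorus d → ℝ := fun x => ∑ j, ‖Torus.partialDeriv j v x‖ ^ 2 with hF
  have hF0 : ∀ x, 0 ≤ F x := fun x => Finset.sum_nonneg fun j _ => sq_nonneg _
  have hFc : Continuous F :=
    continuous_finsetSum _ fun j _ => (((hv.partialDeriv j).continuous).norm).pow 2
  set A : ℝ := 2 / π ^ 2 * Real.sqrt P * Real.sqrt D with hA
  have hA0 : 0 ≤ A := by positivity
  have hFA : ∀ x, F x ≤ A := fun x => Torus.sum_norm_sq_partialDeriv_le_agmon_explicit hd hv x
  -- pointwise `F^m ≤ A^{m-3} F³`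
  have hpt : ∀ x, F x ^ m ≤ A ^ (m - 3) * F x ^ 3 := by
    intro x
    have hne : m - 3 + 3 ≠ 0 := ne_of_gt (by linarith)
    have e : F x ^ m = F x ^ (m - 3) * F x ^ 3 := by
      rw [show (F x ^ 3 : ℝ) = F x ^ (3 : ℝ) by norm_cast, ← Real.rpow_add' (hF0 x) hne]
      congr 1
      ring
    rw [e]
    exact mul_le_mul_of_nonneg_right (Real.rpow_le_rpow (hF0 x) (hFA x) (by linarith))
      (pow_nonneg (hF0 x) 3)
  have hint3 : Integrable (fun x => F x ^ 3) volume := (hFc.pow 3).integrable_unitAddTorus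
  have h1 : ∫ x, F x ^ m ≤ ∫ x, A ^ (m - 3) * F x ^ 3 :=
    integral_mono_of_nonneg (ae_of_all _ fun x => Real.rpow_nonneg (hF0 x) _)
      (hint3.const_mul _) (ae_of_all _ hpt)
  rw [MeasureTheory.integral_const_mul] at h1
  have h2 : A ^ (m - 3) = (2 / π ^ 2) ^ (m - 3) * P ^ ((m - 3) / 2) * D ^ ((m - 3) / 2) := by
    rw [hA, Real.mul_rpow (by positivity) (Real.sqrt_nonneg _),
      Real.mul_rpow hc0 (Real.sqrt_nonneg _), Real.sqrt_eq_rpow, Real.sqrt_eq_rpow,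
      ← Real.rpow_mul hP0, ← Real.rpow_mul hD0, show (1 : ℝ) / 2 * (m - 3) = (m - 3) / 2 by ring]
  have hI3 : 0 ≤ ∫ x, F x ^ 3 := integral_nonneg fun x => pow_nonneg (hF0 x) 3
  have hP3 : P ^ ((m + 3) / 2) = P ^ ((m - 3) / 2) * P ^ 3 := by
    rw [show (P ^ 3 : ℝ) = P ^ (3 : ℝ) by norm_cast,
      ← Real.rpow_add' hP0 (ne_of_gt (by linarith : (0 : ℝ) < (m - 3) / 2 + 3))]
    congr 1
    ring
  calc ∫ x, F x ^ m ≤ A ^ (m - 3) * ∫ x, F x ^ 3 := h1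
    _ ≤ A ^ (m - 3) * (C * P ^ 3) := mul_le_mul_of_nonneg_left hC (Real.rpow_nonneg hA0 _)
    _ = C * (2 / π ^ 2) ^ (m - 3) * P ^ ((m + 3) / 2) * D ^ ((m - 3) / 2) := by
        rw [h2, hP3]; ring

/-! ### Row `n = 1`, `3 < m < ∞` -/

/-- **Gibbon's chessboard, row `n = 1`, `3 < m < ∞`, on `T³`** (classical solutions, explicit up
to `C₆`). On `T^d`, `card d = 3`, for `3 < m` there is `K ≥ 0` (namely
`K = (C₆(2/π²)^{m−3})^{1/(4m−3)}`) such that every classical solution of the unforced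
Navier–Stokes equations with `ν > 0` on `[0, T] × T^d`, `T > 0`, with mean-zero velocity slices
satisfies, with `E = ‖u(0)‖₂²/(2ν)`, `Y₁ = 1/ν + 27‖u(0)‖₂²/(8π⁴ν⁵)`, `B₂ = Y₁^{1/3}(T+E)^{2/3}`,
`W₃ = 3 + (3/2)(3√2/π)^{4/3}(2ν)^{−1/3}B₂`, `β = (m−3)/(2(4m−3))`,
`∫₀ᵀ (∫ |∇u(t)|^{2m})^{1/(4m−3)} dt ≤ K (W₃/ν)^{β} (T + B₂)^{(7m−3)/(2(4m−3))}` — i.e.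
`⟨‖∇u‖_{2m}^{α_{1,m}}⟩_T`, `α_{1,m} = 2m/(4m−3)`, is bounded a priori for every `3 < m < ∞`
(printed for Leray–Hopf weak solutions: `≤ c_{1,m} Re³ + O(T⁻¹)`). Proof as printed (Appendix A
§5.1, `N = 2`): (A.2), then Hölder in time with exponents `2(4m−3)/(m−3)`, `2(4m−3)/(7m−3)`
against the `H³` budget `ν∫₀ᵀ‖∇Δu‖₂²/(1+‖Δu‖₂²)^{4/3} ≤ W₃` and `∫₀ᵀ(1+‖Δu‖₂²)^{1/3} ≤ T + B₂`.
[cite: Gibbon2019Chessboard, Theorem 2 (i) (n = 1, 3 < m < ∞), Appendix A §5.1]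
[cite: FoiasGuillopeTemam1981, Thm 3.1] -/
theorem Torus.exists_classicalNS_integral_gradSq_rpow_le_high (hd : Fintype.card d = 3) {m : ℝ}
    (hm : 3 < m) :
    ∃ K : ℝ, 0 ≤ K ∧ ∀ {ν T : ℝ}, 0 < ν → 0 < T →
      ∀ {u : ℝ → UnitAddTorus d → EuclideanSpace ℝ d} {p : ℝ → UnitAddTorus d → ℝ},
        Torus.IsClassicalNSSolutionOn (Icc 0 T) ν 0 u p →
        (∀ t ∈ Icc 0 T, Torus.HasZeroMean (u t)) →
        ∫ t in (0 : ℝ)..T,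
            (∫ x, (∑ j, ‖Torus.partialDeriv j (u t) x‖ ^ 2) ^ m) ^ (1 / (4 * m - 3)) ≤
          K * ((3 + 3 / 2 * (3 * Real.sqrt 2 / π) ^ ((4 : ℝ) / 3) * (2 * ν) ^ (-(1 : ℝ) / 3) *
              ((1 / ν + 27 * (∫ x, ‖u 0 x‖ ^ 2) / (8 * π ^ 4 * ν ^ 5)) ^ ((1 : ℝ) / 3) *
                (T + (∫ x, ‖u 0 x‖ ^ 2) / (2 * ν)) ^ ((2 : ℝ) / 3))) / ν) ^
              ((m - 3) / (2 * (4 * m - 3))) *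
            (T + (1 / ν + 27 * (∫ x, ‖u 0 x‖ ^ 2) / (8 * π ^ 4 * ν ^ 5)) ^ ((1 : ℝ) / 3) *
              (T + (∫ x, ‖u 0 x‖ ^ 2) / (2 * ν)) ^ ((2 : ℝ) / 3)) ^
              ((7 * m - 3) / (2 * (4 * m - 3))) := by
  obtain ⟨C₆, hC₆0, hC₆⟩ := Torus.exists_integral_gradSq_cube_le_laplacianSq_cube (d := d) hd
  have hπ : 0 < π := Real.pi_pos
  have hc0 : (0 : ℝ) ≤ 2 / π ^ 2 := by positivity
  have h4m : 0 < 4 * m - 3 := by linarith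
  have hm3 : 0 < m - 3 := by linarith
  have h7m : 0 < 7 * m - 3 := by linarith
  -- exponents
  set e : ℝ := 1 / (4 * m - 3) with he
  set β : ℝ := (m - 3) / (2 * (4 * m - 3)) with hβ
  set γ : ℝ := (7 * m - 3) / (2 * (4 * m - 3)) with hγ
  have he0 : 0 < e := by rw [he]; positivity
  have hβ0 : 0 < β := by rw [hβ]; positivity
  have hγ0 : 0 < γ := by rw [hγ]; positivity
  have hCc : 0 ≤ C₆ * (2 / π ^ 2) ^ (m - 3) := by positivity
  set K : ℝ := (C₆ * (2 / π ^ 2) ^ (m - 3)) ^ e with hK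
  have hK0 : 0 ≤ K := Real.rpow_nonneg hCc _
  refine ⟨K, hK0, ?_⟩
  intro ν T hν hT u p h hmean
  have hu0 : 0 ≤ ∫ x, ‖u 0 x‖ ^ 2 := integral_nonneg fun x => sq_nonneg _
  set B₂ : ℝ := (1 / ν + 27 * (∫ x, ‖u 0 x‖ ^ 2) / (8 * π ^ 4 * ν ^ 5)) ^ ((1 : ℝ) / 3) *
    (T + (∫ x, ‖u 0 x‖ ^ 2) / (2 * ν)) ^ ((2 : ℝ) / 3) with hB₂
  set W : ℝ := 3 + 3 / 2 * (3 * Real.sqrt 2 / π) ^ ((4 : ℝ) / 3) * (2 * ν) ^ (-(1 : ℝ) / 3) * B₂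
    with hW
  have hB0 : 0 ≤ B₂ := by positivity
  have hW0 : 0 ≤ W := by positivity
  set P : ℝ → ℝ := fun s => ∫ x, ‖Torus.laplacian (u s) x‖ ^ 2 with hPdef
  set D : ℝ → ℝ := fun s => Torus.gradNormSq (Torus.laplacian (u s)) with hDdef
  have hP0 : ∀ s, 0 ≤ P s := fun s => integral_nonneg fun x => sq_nonneg _
  have hD0 : ∀ s, 0 ≤ D s := fun s => Torus.gradNormSq_nonneg _
  have h1P : ∀ s, 0 < 1 + P s := fun s => by have := hP0 s; positivity
  set w : ℝ → ℝ := fun s => D s / (1 + P s) ^ ((4 : ℝ) / 3) with hw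
  have hw0 : ∀ s, 0 ≤ w s := fun s => div_nonneg (hD0 s) (Real.rpow_nonneg (h1P s).le _)
  -- Hölder factors `a = w^β`, `b = (1+P)^{γ e'}` with `b^{1/(1-β)} = (1+P)^{1/3}`
  set a : ℝ → ℝ := fun s => w s ^ β with ha
  set b : ℝ → ℝ := fun s => (1 + P s) ^ ((7 * m - 3) / (6 * (4 * m - 3))) with hb
  have ha0 : ∀ s, 0 ≤ a s := fun s => Real.rpow_nonneg (hw0 s) _
  have hb0 : ∀ s, 0 ≤ b s := fun s => Real.rpow_nonneg (h1P s).le _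
  -- the integrand and its pointwise bound
  set L : ℝ → ℝ := fun s =>
    (∫ x, (∑ j, ‖Torus.partialDeriv j (u s) x‖ ^ 2) ^ m) ^ e with hL
  have hF0 : ∀ s, 0 ≤ ∫ x, (∑ j, ‖Torus.partialDeriv j (u s) x‖ ^ 2) ^ m := fun s =>
    integral_nonneg fun x => Real.rpow_nonneg (Finset.sum_nonneg fun j _ => sq_nonneg _) _
  have hpt : ∀ s ∈ Icc 0 T, L s ≤ K * (a s * b s) := by
    intro s hs
    have hus : Torus.IsSmooth (u s) := h.smooth_velocity.isSmooth_slice hs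
    have hQ : 0 < (1 + P s) ^ ((4 : ℝ) / 3) := Real.rpow_pos_of_pos (h1P s) _
    have h1 : ∫ x, (∑ j, ‖Torus.partialDeriv j (u s) x‖ ^ 2) ^ m ≤
        C₆ * (2 / π ^ 2) ^ (m - 3) * P s ^ ((m + 3) / 2) * D s ^ ((m - 3) / 2) :=
      Torus.integral_gradSq_rpow_le_of_cube_le_high hd hm hus (hC₆ (u s) hus)
    have h2 := Real.rpow_le_rpow (hF0 s) h1 he0.le
    refine h2.trans ?_
    rw [Real.mul_rpow (mul_nonneg hCc (Real.rpow_nonneg (hP0 s) _)) (Real.rpow_nonneg (hD0 s) _),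
      Real.mul_rpow hCc (Real.rpow_nonneg (hP0 s) _), ← hK, ← Real.rpow_mul (hP0 s),
      ← Real.rpow_mul (hD0 s)]
    have xβ : (m - 3) / 2 * e = β := by rw [hβ, he]; field_simp
    rw [xβ]
    -- `P^{(m+3)e/2} ≤ (1+P)^{(m+3)e/2}`, `D^β = w^β (1+P)^{4β/3}`
    have hθ0 : 0 ≤ (m + 3) / 2 * e := by positivity
    have hP1 : P s ^ ((m + 3) / 2 * e) ≤ (1 + P s) ^ ((m + 3) / 2 * e) :=
      Real.rpow_le_rpow (hP0 s) (by linarith) hθ0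
    have eD : D s ^ β = a s * (1 + P s) ^ ((4 : ℝ) / 3 * β) := by
      have e1 : D s = w s * (1 + P s) ^ ((4 : ℝ) / 3) := by
        rw [hw]; simp only; rw [div_mul_cancel₀ _ hQ.ne']
      show _ = w s ^ β * (1 + P s) ^ ((4 : ℝ) / 3 * β)
      rw [e1, Real.mul_rpow (hw0 s) hQ.le, ← Real.rpow_mul (h1P s).le]
    have eb : (1 + P s) ^ ((m + 3) / 2 * e) * (1 + P s) ^ ((4 : ℝ) / 3 * β) = b s := by
      show _ = (1 + P s) ^ ((7 * m - 3) / (6 * (4 * m - 3)))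
      rw [← Real.rpow_add (h1P s)]
      congr 1
      rw [hβ, he]; field_simp; ring
    calc K * P s ^ ((m + 3) / 2 * e) * D s ^ β
        ≤ K * (1 + P s) ^ ((m + 3) / 2 * e) * D s ^ β :=
          mul_le_mul_of_nonneg_right (mul_le_mul_of_nonneg_left hP1 hK0) (Real.rpow_nonneg (hD0 s) _)
      _ = K * (a s * ((1 + P s) ^ ((m + 3) / 2 * e) * (1 + P s) ^ ((4 : ℝ) / 3 * β))) := by
          rw [eD]; ring
      _ = K * (a s * b s) := by rw [eb]
  -- continuity on `[0, T]`
  obtain ⟨hFc, -, hPc, hDc⟩ := continuousOn_four hT h (by linarith : (0 : ℝ) ≤ m)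
  have h1Pc : ContinuousOn (fun s => 1 + P s) (Icc 0 T) := continuousOn_const.add hPc
  have hwc : ContinuousOn w (Icc 0 T) :=
    hDc.div (h1Pc.rpow_const fun s _ => Or.inl (h1P s).ne')
      fun s _ => (Real.rpow_pos_of_pos (h1P s) _).ne'
  have hac : ContinuousOn a (Icc 0 T) := hwc.rpow_const fun s _ => Or.inr hβ0.le
  have hbc : ContinuousOn b (Icc 0 T) := h1Pc.rpow_const fun s _ => Or.inl (h1P s).ne'
  have hLc : ContinuousOn L (Icc 0 T) := hFc.rpow_const fun s _ => Or.inr he0.le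
  -- Hölder in time, `p₁ = 1/β`, `q₁ = 1/γ`
  have hm3ne : m - 3 ≠ 0 := hm3.ne'
  have h4mne : 4 * m - 3 ≠ 0 := h4m.ne'
  have h7mne : 7 * m - 3 ≠ 0 := h7m.ne'
  set p₁ : ℝ := 2 * (4 * m - 3) / (m - 3) with hp₁
  set q₁ : ℝ := 2 * (4 * m - 3) / (7 * m - 3) with hq₁
  have hpq : p₁.HolderConjugate q₁ := by
    refine Real.holderConjugate_iff.2 ⟨?_, ?_⟩
    · rw [hp₁, lt_div_iff₀ hm3]; linarith
    · rw [hp₁, hq₁]; field_simp; ring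
  set μ : Measure ℝ := volume.restrict (Ioc 0 T) with hμ
  haveI : IsFiniteMeasure μ := by rw [hμ]; infer_instance
  have hmemLp : ∀ {g : ℝ → ℝ}, ContinuousOn g (Icc 0 T) → ∀ r : ℝ≥0∞, MemLp g r μ := by
    intro g hg r
    obtain ⟨C', hC'⟩ := isCompact_Icc.exists_bound_of_continuousOn hg
    have hmeas : AEStronglyMeasurable g μ :=
      (hg.mono Ioc_subset_Icc_self).aestronglyMeasurable measurableSet_Ioc
    refine MemLp.of_bound hmeas C' ?_
    rw [hμ, ae_restrict_iff' measurableSet_Ioc]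
    exact ae_of_all _ fun s hs => hC' s (Ioc_subset_Icc_self hs)
  have hH := integral_mul_le_Lp_mul_Lq_of_nonneg (μ := μ) hpq
    (ae_of_all _ fun s => ha0 s) (ae_of_all _ fun s => hb0 s) (hmemLp hac _) (hmemLp hbc _)
  have hap : ∀ s, a s ^ p₁ = w s := fun s => by
    rw [ha]; simp only; rw [← Real.rpow_mul (hw0 s)]
    have : β * p₁ = 1 := by
      rw [hβ, hp₁, div_mul_div_comm, div_eq_one_iff_eq (by positivity)]; ring
    rw [this, Real.rpow_one]
  have hbq : ∀ s, b s ^ q₁ = (1 + P s) ^ ((1 : ℝ) / 3) := fun s => by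
    rw [hb]; simp only; rw [← Real.rpow_mul (h1P s).le]
    congr 1
    rw [hq₁, div_mul_div_comm, div_eq_div_iff (by positivity) (by norm_num)]
    ring
  have hI2 : ∫ s, a s ^ p₁ ∂μ = ∫ t in (0 : ℝ)..T, w t := by
    rw [intervalIntegral.integral_of_le hT.le, hμ]
    exact integral_congr_ae (ae_of_all _ fun s => hap s)
  have hI3 : ∫ s, b s ^ q₁ ∂μ = ∫ t in (0 : ℝ)..T, (1 + P t) ^ ((1 : ℝ) / 3) := by
    rw [intervalIntegral.integral_of_le hT.le, hμ]
    exact integral_congr_ae (ae_of_all _ fun s => hbq s)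
  rw [hI2, hI3] at hH
  -- the two budgets
  have hA : ∫ t in (0 : ℝ)..T, w t ≤ W / ν := by
    rw [le_div_iff₀ hν, mul_comm]
    have := Torus.classicalNS_integral_gradNormSq_laplacian_div_le hd hν hT h hmean
    simpa [hW, hB₂] using this
  have hB : ∫ t in (0 : ℝ)..T, (1 + P t) ^ ((1 : ℝ) / 3) ≤ T + B₂ := by
    have h13 : ∀ t, (1 + P t) ^ ((1 : ℝ) / 3) ≤ 1 + P t ^ ((1 : ℝ) / 3) := fun t => by
      have := Real.rpow_add_le_add_rpow zero_le_one (hP0 t) (by norm_num : (0 : ℝ) ≤ 1 / 3)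
        (by norm_num)
      simpa using this
    have hP13c : ContinuousOn (fun s => P s ^ ((1 : ℝ) / 3)) (Icc 0 T) :=
      hPc.rpow_const fun s _ => Or.inr (by norm_num)
    have hP13i : IntervalIntegrable (fun s => P s ^ ((1 : ℝ) / 3)) volume 0 T :=
      (hP13c.mono (by rw [uIcc_of_le hT.le])).intervalIntegrable
    have hmono : ∫ t in (0 : ℝ)..T, (1 + P t) ^ ((1 : ℝ) / 3) ≤
        ∫ t in (0 : ℝ)..T, (1 + P t ^ ((1 : ℝ) / 3)) := by
      refine intervalIntegral.integral_mono_on hT.le ?_ (intervalIntegrable_const.add hP13i)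
        fun t _ => h13 t
      exact ((h1Pc.rpow_const fun s _ => Or.inl (h1P s).ne').mono
        (by rw [uIcc_of_le hT.le])).intervalIntegrable
    rw [intervalIntegral.integral_add intervalIntegrable_const hP13i, intervalIntegral.integral_const,
      smul_eq_mul, sub_zero, mul_one] at hmono
    have hE := Torus.classicalNS_integral_laplacian_twoThirds_le hd hν hT h hmean
    rw [← hB₂] at hE
    linarith
  have hA0 : 0 ≤ ∫ t in (0 : ℝ)..T, w t := intervalIntegral.integral_nonneg hT.le fun s _ => hw0 s
  have hB0' : 0 ≤ ∫ t in (0 : ℝ)..T, (1 + P t) ^ ((1 : ℝ) / 3) :=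
    intervalIntegral.integral_nonneg hT.le fun s _ => Real.rpow_nonneg (h1P s).le _
  have x1p : 1 / p₁ = β := by rw [hp₁, hβ, one_div_div]
  have x1q : 1 / q₁ = γ := by rw [hq₁, hγ, one_div_div]
  have hH' : ∫ s, a s * b s ∂μ ≤ (W / ν) ^ β * (T + B₂) ^ γ := by
    refine hH.trans ?_
    rw [x1p, x1q]
    exact mul_le_mul (Real.rpow_le_rpow hA0 hA hβ0.le) (Real.rpow_le_rpow hB0' hB hγ0.le)
      (Real.rpow_nonneg hB0' _) (Real.rpow_nonneg (hA0.trans hA) _)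
  -- compare the integrands and integrate
  have hmono : ∫ t in (0 : ℝ)..T, L t ≤ ∫ t in (0 : ℝ)..T, K * (a t * b t) := by
    refine intervalIntegral.integral_mono_on hT.le ?_ ?_ hpt
    · exact (hLc.mono (by rw [uIcc_of_le hT.le])).intervalIntegrable
    · exact ((continuousOn_const.mul (hac.mul hbc)).mono (by rw [uIcc_of_le hT.le])).intervalIntegrable
  have hI1 : ∫ t in (0 : ℝ)..T, K * (a t * b t) = K * ∫ s, a s * b s ∂μ := by
    rw [intervalIntegral.integral_const_mul, intervalIntegral.integral_of_le hT.le, hμ]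
  calc ∫ t in (0 : ℝ)..T, L t ≤ K * ∫ s, a s * b s ∂μ := hmono.trans (le_of_eq hI1)
    _ ≤ K * ((W / ν) ^ β * (T + B₂) ^ γ) := mul_le_mul_of_nonneg_left hH' hK0
    _ = K * (W / ν) ^ β * (T + B₂) ^ γ := by ring

/-- **Vorticity moments `∫₀ᵀ ‖ω‖_{2m}^{2m/(4m−3)} dt` bounded a priori, `3 < m < ∞`, on `T³`**
(Gibbon's `⟨D_m⟩_T` for large `m`; `|ω|² = torusVorticitySqAt ≤ 2|∇u|²` pointwise): with
`K, W₃, B₂, β` as in `Torus.exists_classicalNS_integral_gradSq_rpow_le_high`, the same bound with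
`2^{m/(4m−3)}K`. [cite: Gibbon2019Chessboard, Theorem 1 / Remark 2 eq. (2.12) (n = 1, 3 < m < ∞)] -/
theorem Torus.exists_classicalNS_integral_vorticitySq_rpow_le_high (hd : Fintype.card d = 3)
    {m : ℝ} (hm : 3 < m) :
    ∃ K : ℝ, 0 ≤ K ∧ ∀ {ν T : ℝ}, 0 < ν → 0 < T →
      ∀ {u : ℝ → UnitAddTorus d → EuclideanSpace ℝ d} {p : ℝ → UnitAddTorus d → ℝ},
        Torus.IsClassicalNSSolutionOn (Icc 0 T) ν 0 u p →
        (∀ t ∈ Icc 0 T, Torus.HasZeroMean (u t)) →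
        ∫ t in (0 : ℝ)..T, (∫ x, torusVorticitySqAt (u t) x ^ m) ^ (1 / (4 * m - 3)) ≤
          K * ((3 + 3 / 2 * (3 * Real.sqrt 2 / π) ^ ((4 : ℝ) / 3) * (2 * ν) ^ (-(1 : ℝ) / 3) *
              ((1 / ν + 27 * (∫ x, ‖u 0 x‖ ^ 2) / (8 * π ^ 4 * ν ^ 5)) ^ ((1 : ℝ) / 3) *
                (T + (∫ x, ‖u 0 x‖ ^ 2) / (2 * ν)) ^ ((2 : ℝ) / 3))) / ν) ^
              ((m - 3) / (2 * (4 * m - 3))) *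
            (T + (1 / ν + 27 * (∫ x, ‖u 0 x‖ ^ 2) / (8 * π ^ 4 * ν ^ 5)) ^ ((1 : ℝ) / 3) *
              (T + (∫ x, ‖u 0 x‖ ^ 2) / (2 * ν)) ^ ((2 : ℝ) / 3)) ^
              ((7 * m - 3) / (2 * (4 * m - 3))) := by
  obtain ⟨K, hK0, hK⟩ := Torus.exists_classicalNS_integral_gradSq_rpow_le_high (d := d) hd hm
  have h4m : 0 < 4 * m - 3 := by linarith
  have hm0 : (0 : ℝ) ≤ m := by linarith
  set e : ℝ := 1 / (4 * m - 3) with he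
  have he0 : 0 < e := by rw [he]; positivity
  refine ⟨(2 : ℝ) ^ (m * e) * K, by positivity, ?_⟩
  intro ν T hν hT u p h hmean
  have hmain := hK hν hT h hmean
  have hpt : ∀ s ∈ Icc 0 T, (∫ x, torusVorticitySqAt (u s) x ^ m) ^ e ≤
      (2 : ℝ) ^ (m * e) * (∫ x, (∑ j, ‖Torus.partialDeriv j (u s) x‖ ^ 2) ^ m) ^ e := by
    intro s hs
    have hus : Torus.IsSmooth (u s) := h.smooth_velocity.isSmooth_slice hs
    set F : UnitAddTorus d → ℝ := fun x => ∑ j, ‖Torus.partialDeriv j (u s) x‖ ^ 2 with hF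
    have hF0 : ∀ x, 0 ≤ F x := fun x => Finset.sum_nonneg fun j _ => sq_nonneg _
    have hFc : Continuous F :=
      continuous_finsetSum _ fun j _ => (((hus.partialDeriv j).continuous).norm).pow 2
    have hω0 : ∀ x, 0 ≤ torusVorticitySqAt (u s) x := fun x => torusVorticitySqAt_nonneg _ _
    have h1 : ∫ x, torusVorticitySqAt (u s) x ^ m ≤ ∫ x, (2 * F x) ^ m :=
      integral_mono_of_nonneg (ae_of_all _ fun x => Real.rpow_nonneg (hω0 x) _)
        (((continuous_const.mul hFc).rpow_const fun x => Or.inr hm0).integrable_unitAddTorus)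
        (ae_of_all _ fun x => Real.rpow_le_rpow (hω0 x)
          (torusVorticitySqAt_le_two_mul_sum_norm_sq (u s) x) hm0)
    have h2 : ∫ x, (2 * F x) ^ m = (2 : ℝ) ^ m * ∫ x, F x ^ m := by
      have e2 : ∀ x, (2 * F x) ^ m = (2 : ℝ) ^ m * F x ^ m := fun x =>
        Real.mul_rpow zero_le_two (hF0 x)
      simp_rw [e2]
      exact MeasureTheory.integral_const_mul _ _
    have hI0 : 0 ≤ ∫ x, torusVorticitySqAt (u s) x ^ m :=
      integral_nonneg fun x => Real.rpow_nonneg (hω0 x) _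
    have hJ0 : 0 ≤ ∫ x, F x ^ m := integral_nonneg fun x => Real.rpow_nonneg (hF0 x) _
    calc (∫ x, torusVorticitySqAt (u s) x ^ m) ^ e ≤ ((2 : ℝ) ^ m * ∫ x, F x ^ m) ^ e :=
          Real.rpow_le_rpow hI0 (h1.trans_eq h2) he0.le
      _ = ((2 : ℝ) ^ m) ^ e * (∫ x, F x ^ m) ^ e := Real.mul_rpow (by positivity) hJ0
      _ = (2 : ℝ) ^ (m * e) * (∫ x, F x ^ m) ^ e := by rw [← Real.rpow_mul zero_le_two]
  obtain ⟨hFc, hΩc, -, -⟩ := continuousOn_four hT h hm0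
  have hLc := hFc.rpow_const fun s (_ : s ∈ Icc 0 T) => Or.inr he0.le
  have hΩc' := hΩc.rpow_const fun s (_ : s ∈ Icc 0 T) => Or.inr he0.le
  have hmono : ∫ t in (0 : ℝ)..T, (∫ x, torusVorticitySqAt (u t) x ^ m) ^ e ≤
      ∫ t in (0 : ℝ)..T,
        (2 : ℝ) ^ (m * e) * (∫ x, (∑ j, ‖Torus.partialDeriv j (u t) x‖ ^ 2) ^ m) ^ e := by
    refine intervalIntegral.integral_mono_on hT.le ?_ ?_ hpt
    · exact (hΩc'.mono (by rw [uIcc_of_le hT.le])).intervalIntegrable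
    · exact ((continuousOn_const.mul hLc).mono (by rw [uIcc_of_le hT.le])).intervalIntegrable
  rw [intervalIntegral.integral_const_mul] at hmono
  refine hmono.trans ?_
  refine (mul_le_mul_of_nonneg_left hmain (by positivity)).trans (le_of_eq ?_)
  ring

/-! ### Row `n = 2`, `1 < m < 3`: second derivatives -/

/-- Along a classical solution on `[a, b]`, `t ↦ ∫ (∑ⱼ∑ᵢ‖∂ᵢ∂ⱼu(t)‖²)^m` is continuous (`0 ≤ m`).
[folklore] -/
private theorem continuousOn_integral_hessSq_rpow {ν a b : ℝ} (hab : a < b)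
    {f u : ℝ → UnitAddTorus d → EuclideanSpace ℝ d} {p : ℝ → UnitAddTorus d → ℝ}
    (h : Torus.IsClassicalNSSolutionOn (Icc a b) ν f u p) {m : ℝ} (hm : 0 ≤ m) :
    ContinuousOn (fun t => ∫ x,
      (∑ j, ∑ i, ‖Torus.partialDeriv i (Torus.partialDeriv j (u t)) x‖ ^ 2) ^ m) (Icc a b) := by
  have hU : UniqueDiffOn ℝ (Icc a b) := uniqueDiffOn_Icc hab
  have hst : ∀ i j, ContinuousOn
      (Torus.stLift fun t => Torus.partialDeriv i (Torus.partialDeriv j (u t))) (Icc a b ×ˢ univ) :=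
    fun i j => ((h.smooth_velocity.partialDeriv hU j).partialDeriv hU i).continuousOn_stLift
  refine continuousOn_integral_of_continuousOn_stLift'' ?_ fun t ht => ?_
  · have e : Torus.stLift (fun t x =>
        (∑ j, ∑ i, ‖Torus.partialDeriv i (Torus.partialDeriv j (u t)) x‖ ^ 2) ^ m) =
        fun q => (∑ j, ∑ i,
          ‖Torus.stLift (fun t => Torus.partialDeriv i (Torus.partialDeriv j (u t))) q‖ ^ 2) ^ m :=
      rfl
    rw [e]
    exact (continuousOn_finsetSum _ fun j _ => continuousOn_finsetSum _ fun i _ =>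
      ((hst i j).norm).pow 2).rpow_const fun q _ => Or.inr hm
  · have hut : Torus.IsSmooth (u t) := h.smooth_velocity.isSmooth_slice ht
    exact (continuous_finsetSum _ fun j _ => continuous_finsetSum _ fun i _ =>
      ((((hut.partialDeriv j).partialDeriv i).continuous).norm).pow 2).rpow_const
        fun x => Or.inr hm

/-- **Sobolev for the Hessian on `T³`**: there is `C ≥ 0` with
`∫ (∑ⱼ∑ᵢ‖∂ᵢ∂ⱼv‖²)³ ≤ C (‖∇Δv‖₂²)³` for every smooth `v` on `T^d`, `card d = 3` (Jensen
`(∑ⱼᵢa)³ ≤ d⁴∑ⱼᵢa³`, the mean-zero embedding `∫‖w‖⁶ ≤ C₀(∫|∇w|²)³` for `w = ∂ᵢ∂ⱼv`, and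
`‖∇∂ᵢ∂ⱼv‖₂² ≤ ‖∇Δv‖₂²`, `Torus.gradNormSq_partialDeriv_partialDeriv_le`).
[cite: RobinsonRodrigoSadowskiCUP2016, Thm 1.18 (H¹ ⊂ L⁶ on T³), applied to ∂ᵢ∂ⱼv] -/
theorem Torus.exists_integral_hessSq_cube_le_gradNormSq_laplacian_cube (hd : Fintype.card d = 3) :
    ∃ C : ℝ, 0 ≤ C ∧ ∀ v : UnitAddTorus d → EuclideanSpace ℝ d, Torus.IsSmooth v →
      ∫ x, (∑ j, ∑ i, ‖Torus.partialDeriv i (Torus.partialDeriv j v) x‖ ^ 2) ^ 3 ≤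
        C * Torus.gradNormSq (Torus.laplacian v) ^ 3 := by
  obtain ⟨C₀, hC₀0, hC₀⟩ := Torus.exists_integral_norm_pow_six_le_gradNormSq_cube (d := d) hd
  set n : ℝ := (Fintype.card d : ℝ) with hn
  have hn0 : 0 ≤ n := Nat.cast_nonneg _
  refine ⟨n ^ 2 * (n * (n ^ 2 * (n * C₀))), by positivity, fun v hv => ?_⟩
  set D : ℝ := Torus.gradNormSq (Torus.laplacian v) with hDdef
  have hD0 : 0 ≤ D := Torus.gradNormSq_nonneg _
  have hDD : ∀ i j, Torus.IsSmooth (Torus.partialDeriv i (Torus.partialDeriv j v)) :=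
    fun i j => (hv.partialDeriv j).partialDeriv i
  -- each entry: `∫‖∂ᵢ∂ⱼv‖⁶ ≤ C₀ D³`
  have hij : ∀ i j, ∫ x, ‖Torus.partialDeriv i (Torus.partialDeriv j v) x‖ ^ 6 ≤ C₀ * D ^ 3 := by
    intro i j
    have h0 : Torus.HasZeroMean (Torus.partialDeriv i (Torus.partialDeriv j v)) :=
      Torus.hasZeroMean_partialDeriv (hv.partialDeriv j) i
    have h1 := hC₀ _ (hDD i j) h0
    have h2 : Torus.gradNormSq (Torus.partialDeriv i (Torus.partialDeriv j v)) ≤ D :=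
      Torus.gradNormSq_partialDeriv_partialDeriv_le hv i j
    exact h1.trans (mul_le_mul_of_nonneg_left
      (pow_le_pow_left₀ (Torus.gradNormSq_nonneg _) h2 3) hC₀0)
  -- Jensen twice
  have hpt : ∀ x, (∑ j, ∑ i, ‖Torus.partialDeriv i (Torus.partialDeriv j v) x‖ ^ 2) ^ 3 ≤
      n ^ 2 * ∑ j, n ^ 2 * ∑ i, ‖Torus.partialDeriv i (Torus.partialDeriv j v) x‖ ^ 6 := by
    intro x
    have hJ : ∀ (g : d → ℝ), (∀ k, 0 ≤ g k) → (∑ k, g k) ^ 3 ≤ n ^ 2 * ∑ k, g k ^ 3 := by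
      intro g hg
      have h := pow_sum_le_card_mul_sum_pow (s := Finset.univ) (f := g) (fun k _ => hg k) 2
      simp only [Finset.card_univ] at h
      rw [hn]
      exact_mod_cast h
    have h1 := hJ (fun j => ∑ i, ‖Torus.partialDeriv i (Torus.partialDeriv j v) x‖ ^ 2)
      fun j => Finset.sum_nonneg fun i _ => sq_nonneg _
    refine h1.trans (mul_le_mul_of_nonneg_left (Finset.sum_le_sum fun j _ => ?_) (by positivity))
    have h2 := hJ (fun i => ‖Torus.partialDeriv i (Torus.partialDeriv j v) x‖ ^ 2)
      fun i => sq_nonneg _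
    refine h2.trans (le_of_eq ?_)
    congr 1
    exact Finset.sum_congr rfl fun i _ => by ring
  have hint6 : ∀ i j, Integrable (fun x => ‖Torus.partialDeriv i (Torus.partialDeriv j v) x‖ ^ 6)
      volume := fun i j => ((hDD i j).continuous.norm.pow 6).integrable_unitAddTorus
  have hcont : Continuous fun x =>
      ∑ j, ∑ i, ‖Torus.partialDeriv i (Torus.partialDeriv j v) x‖ ^ 2 :=
    continuous_finsetSum _ fun j _ => continuous_finsetSum _ fun i _ =>
      ((hDD i j).continuous.norm).pow 2
  have hintL : Integrable (fun x =>
      (∑ j, ∑ i, ‖Torus.partialDeriv i (Torus.partialDeriv j v) x‖ ^ 2) ^ 3) volume :=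
    (hcont.pow 3).integrable_unitAddTorus
  have hinner : ∀ j, Integrable (fun x =>
      n ^ 2 * ∑ i, ‖Torus.partialDeriv i (Torus.partialDeriv j v) x‖ ^ 6) volume :=
    fun j => (integrable_finsetSum _ fun i _ => hint6 i j).const_mul _
  have hintR : Integrable (fun x =>
      n ^ 2 * ∑ j, n ^ 2 * ∑ i, ‖Torus.partialDeriv i (Torus.partialDeriv j v) x‖ ^ 6) volume :=
    (integrable_finsetSum _ fun j _ => hinner j).const_mul _
  calc ∫ x, (∑ j, ∑ i, ‖Torus.partialDeriv i (Torus.partialDeriv j v) x‖ ^ 2) ^ 3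
      ≤ ∫ x, n ^ 2 * ∑ j, n ^ 2 * ∑ i, ‖Torus.partialDeriv i (Torus.partialDeriv j v) x‖ ^ 6 :=
        integral_mono hintL hintR hpt
    _ = n ^ 2 * ∑ j, n ^ 2 * ∑ i, ∫ x, ‖Torus.partialDeriv i (Torus.partialDeriv j v) x‖ ^ 6 := by
        rw [MeasureTheory.integral_const_mul, integral_finsetSum _ fun j _ => hinner j]
        congr 1
        refine Finset.sum_congr rfl fun j _ => ?_
        rw [MeasureTheory.integral_const_mul, integral_finsetSum _ fun i _ => hint6 i j]
    _ ≤ n ^ 2 * ∑ _j : d, n ^ 2 * ∑ _i : d, C₀ * D ^ 3 := by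
        gcongr with j _ i _
        exact hij i j
    _ = n ^ 2 * (n * (n ^ 2 * (n * C₀))) * Torus.gradNormSq (Torus.laplacian v) ^ 3 := by
        simp only [Finset.sum_const, Finset.card_univ, nsmul_eq_mul, ← hn, hDdef]
        ring

/-- **(A.2) for second derivatives, `1 < m < 3`** (`L²`–`L⁶` interpolation + the Hessian Sobolev
bound): for a smooth `v` on `T^d` with `∫(∑ⱼᵢ‖∂ᵢ∂ⱼv‖²)³ ≤ C(‖∇Δv‖₂²)³`,
`∫ (∑ⱼᵢ‖∂ᵢ∂ⱼv‖²)^m ≤ C^{(m−1)/2} (∫‖Δv‖²)^{(3−m)/2} (‖∇Δv‖₂²)^{3(m−1)/2}`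
(`∫∑ⱼᵢ‖∂ᵢ∂ⱼv‖² = ∫‖Δv‖²`, `Torus.integral_sum_sum_norm_partialDeriv_partialDeriv_sq_eq`).
[cite: Gibbon2019Chessboard, Appendix A §5.1 eq. (A.2) (n = 2)] -/
theorem Torus.integral_hessSq_rpow_le_of_cube_le {m : ℝ} (hm1 : 1 < m) (hm3 : m < 3)
    {v : UnitAddTorus d → EuclideanSpace ℝ d} (hv : Torus.IsSmooth v) {C : ℝ} (hC0 : 0 ≤ C)
    (hC : ∫ x, (∑ j, ∑ i, ‖Torus.partialDeriv i (Torus.partialDeriv j v) x‖ ^ 2) ^ 3 ≤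
      C * Torus.gradNormSq (Torus.laplacian v) ^ 3) :
    ∫ x, (∑ j, ∑ i, ‖Torus.partialDeriv i (Torus.partialDeriv j v) x‖ ^ 2) ^ m ≤
      C ^ ((m - 1) / 2) * (∫ x, ‖Torus.laplacian v x‖ ^ 2) ^ ((3 - m) / 2) *
        Torus.gradNormSq (Torus.laplacian v) ^ (3 * (m - 1) / 2) := by
  set F : UnitAddTorus d → ℝ := fun x =>
    ∑ j, ∑ i, ‖Torus.partialDeriv i (Torus.partialDeriv j v) x‖ ^ 2 with hF
  set f : UnitAddTorus d → ℝ := fun x => Real.sqrt (F x) with hf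
  set P : ℝ := ∫ x, ‖Torus.laplacian v x‖ ^ 2 with hPdef
  set D : ℝ := Torus.gradNormSq (Torus.laplacian v) with hDdef
  have hP0 : 0 ≤ P := integral_nonneg fun x => sq_nonneg _
  have hD0 : 0 ≤ D := Torus.gradNormSq_nonneg _
  have hDD : ∀ i j, Torus.IsSmooth (Torus.partialDeriv i (Torus.partialDeriv j v)) :=
    fun i j => (hv.partialDeriv j).partialDeriv i
  have hF0 : ∀ x, 0 ≤ F x := fun x =>
    Finset.sum_nonneg fun j _ => Finset.sum_nonneg fun i _ => sq_nonneg _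
  have hFc : Continuous F := continuous_finsetSum _ fun j _ => continuous_finsetSum _ fun i _ =>
    ((hDD i j).continuous.norm).pow 2
  have hfc : Continuous f := Real.continuous_sqrt.comp hFc
  have hf0 : ∀ x, 0 ≤ f x := fun x => Real.sqrt_nonneg _
  have hf2 : ∀ x, f x ^ 2 = F x := fun x => Real.sq_sqrt (hF0 x)
  have hG : ∫ x, f x ^ 2 = P := by
    simp only [hf2, hF, hPdef]
    exact Torus.integral_sum_sum_norm_partialDeriv_partialDeriv_sq_eq hv
  have hf6 : ∫ x, f x ^ 6 ≤ C * D ^ 3 := by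
    have e : ∀ x, f x ^ 6 = F x ^ 3 := fun x => by rw [← hf2]; ring
    simp only [e]
    exact hC
  have hI6 : 0 ≤ ∫ x, f x ^ 6 := integral_nonneg fun x => pow_nonneg (hf0 x) 6
  have hfm : ∀ x, f x ^ (2 * m) = F x ^ m := fun x => by
    rw [Real.rpow_mul (hf0 x), Real.rpow_two, hf2]
  have hq2 : 2 < 2 * m := by linarith
  have hq6 : 2 * m < 6 := by linarith
  have hI := Torus.integral_rpow_le_interpolate_two_six' hq2 hq6 hfc hf0
  simp only [hfm] at hI
  rw [hG] at hI
  have x1 : (6 - 2 * m) / 4 = (3 - m) / 2 := by ring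
  have x2 : (2 * m - 2) / 4 = (m - 1) / 2 := by ring
  rw [x1, x2] at hI
  refine hI.trans ?_
  have h1 : (∫ x, f x ^ 6) ^ ((m - 1) / 2) ≤ (C * D ^ 3) ^ ((m - 1) / 2) :=
    Real.rpow_le_rpow hI6 hf6 (by linarith)
  have h2 : (C * D ^ 3) ^ ((m - 1) / 2) = C ^ ((m - 1) / 2) * D ^ (3 * (m - 1) / 2) := by
    rw [Real.mul_rpow hC0 (by positivity), show (D ^ 3 : ℝ) = D ^ (3 : ℝ) by norm_cast,
      ← Real.rpow_mul hD0]
    congr 1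
    congr 1
    ring
  calc P ^ ((3 - m) / 2) * (∫ x, f x ^ 6) ^ ((m - 1) / 2)
      ≤ P ^ ((3 - m) / 2) * (C * D ^ 3) ^ ((m - 1) / 2) :=
        mul_le_mul_of_nonneg_left h1 (Real.rpow_nonneg hP0 _)
    _ = C ^ ((m - 1) / 2) * P ^ ((3 - m) / 2) * D ^ (3 * (m - 1) / 2) := by rw [h2]; ring

/-- **Gibbon's chessboard, row `n = 2`, `1 < m < 3`, on `T³`** (classical solutions, explicit up
to the Hessian Sobolev constant). On `T^d`, `card d = 3`, for `1 < m < 3` there is `K ≥ 0` such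
that every classical solution of the unforced Navier–Stokes equations with `ν > 0` on
`[0, T] × T^d`, `T > 0`, with mean-zero velocity slices satisfies, with `E, Y₁, B₂, W₃` as in
`Torus.exists_classicalNS_integral_gradSq_rpow_le_high`,
`∫₀ᵀ (∫ |∇²u(t)|^{2m})^{1/(6m−3)} dt ≤ K (W₃/ν)^{(m−1)/(2(2m−1))} (T + B₂)^{(3m−1)/(2(2m−1))}`,
`|∇²u|² = ∑ⱼ∑ᵢ‖∂ᵢ∂ⱼu‖²` — i.e. `⟨‖∇²u‖_{2m}^{α_{2,m}}⟩_T`, `α_{2,m} = 2m/(6m−3)`, is bounded a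
priori (printed for Leray–Hopf weak solutions, `n = 2`, `1 ≤ m ≤ ∞`; here `N = 1` relative to the
`H³` rung, `1 < m < 3`; `m = 1` is the `H²` rung `∫‖Δu‖₂^{2/3}`, `m = 3` the `H³` square `(3,1)`).
[cite: Gibbon2019Chessboard, Theorem 2 (i) (n = 2, 1 < m < 3), Appendix A §5.1]
[cite: FoiasGuillopeTemam1981, Thm 3.1] -/
theorem Torus.exists_classicalNS_integral_hessSq_rpow_le (hd : Fintype.card d = 3) {m : ℝ}
    (hm1 : 1 < m) (hm3 : m < 3) :
    ∃ K : ℝ, 0 ≤ K ∧ ∀ {ν T : ℝ}, 0 < ν → 0 < T →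
      ∀ {u : ℝ → UnitAddTorus d → EuclideanSpace ℝ d} {p : ℝ → UnitAddTorus d → ℝ},
        Torus.IsClassicalNSSolutionOn (Icc 0 T) ν 0 u p →
        (∀ t ∈ Icc 0 T, Torus.HasZeroMean (u t)) →
        ∫ t in (0 : ℝ)..T, (∫ x,
            (∑ j, ∑ i, ‖Torus.partialDeriv i (Torus.partialDeriv j (u t)) x‖ ^ 2) ^ m) ^
              (1 / (6 * m - 3)) ≤
          K * ((3 + 3 / 2 * (3 * Real.sqrt 2 / π) ^ ((4 : ℝ) / 3) * (2 * ν) ^ (-(1 : ℝ) / 3) *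
              ((1 / ν + 27 * (∫ x, ‖u 0 x‖ ^ 2) / (8 * π ^ 4 * ν ^ 5)) ^ ((1 : ℝ) / 3) *
                (T + (∫ x, ‖u 0 x‖ ^ 2) / (2 * ν)) ^ ((2 : ℝ) / 3))) / ν) ^
              ((m - 1) / (2 * (2 * m - 1))) *
            (T + (1 / ν + 27 * (∫ x, ‖u 0 x‖ ^ 2) / (8 * π ^ 4 * ν ^ 5)) ^ ((1 : ℝ) / 3) *
              (T + (∫ x, ‖u 0 x‖ ^ 2) / (2 * ν)) ^ ((2 : ℝ) / 3)) ^
              ((3 * m - 1) / (2 * (2 * m - 1))) := by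
  obtain ⟨C, hC0, hC⟩ := Torus.exists_integral_hessSq_cube_le_gradNormSq_laplacian_cube (d := d) hd
  have hπ : 0 < π := Real.pi_pos
  have h6m : 0 < 6 * m - 3 := by linarith
  have h2m : 0 < 2 * m - 1 := by linarith
  have hm1' : 0 < m - 1 := by linarith
  have h3m1 : 0 < 3 * m - 1 := by linarith
  have hm1ne : m - 1 ≠ 0 := hm1'.ne'
  have h2mne : 2 * m - 1 ≠ 0 := h2m.ne'
  have h6mne : 6 * m - 3 ≠ 0 := h6m.ne'
  have h3m1ne : 3 * m - 1 ≠ 0 := h3m1.ne'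
  have h63 : (6 : ℝ) * m - 3 = 3 * (2 * m - 1) := by ring
  -- exponents
  set e : ℝ := 1 / (6 * m - 3) with he
  set β : ℝ := (m - 1) / (2 * (2 * m - 1)) with hβ
  set γ : ℝ := (3 * m - 1) / (2 * (2 * m - 1)) with hγ
  have he0 : 0 < e := by rw [he]; positivity
  have hβ0 : 0 < β := by rw [hβ]; positivity
  have hγ0 : 0 < γ := by rw [hγ]; positivity
  set K : ℝ := C ^ ((m - 1) / 2 * e) with hK
  have hK0 : 0 ≤ K := Real.rpow_nonneg hC0 _
  refine ⟨K, hK0, ?_⟩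
  intro ν T hν hT u p h hmean
  have hu0 : 0 ≤ ∫ x, ‖u 0 x‖ ^ 2 := integral_nonneg fun x => sq_nonneg _
  set B₂ : ℝ := (1 / ν + 27 * (∫ x, ‖u 0 x‖ ^ 2) / (8 * π ^ 4 * ν ^ 5)) ^ ((1 : ℝ) / 3) *
    (T + (∫ x, ‖u 0 x‖ ^ 2) / (2 * ν)) ^ ((2 : ℝ) / 3) with hB₂
  set W : ℝ := 3 + 3 / 2 * (3 * Real.sqrt 2 / π) ^ ((4 : ℝ) / 3) * (2 * ν) ^ (-(1 : ℝ) / 3) * B₂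
    with hW
  have hB0 : 0 ≤ B₂ := by positivity
  have hW0 : 0 ≤ W := by positivity
  set P : ℝ → ℝ := fun s => ∫ x, ‖Torus.laplacian (u s) x‖ ^ 2 with hPdef
  set D : ℝ → ℝ := fun s => Torus.gradNormSq (Torus.laplacian (u s)) with hDdef
  have hP0 : ∀ s, 0 ≤ P s := fun s => integral_nonneg fun x => sq_nonneg _
  have hD0 : ∀ s, 0 ≤ D s := fun s => Torus.gradNormSq_nonneg _
  have h1P : ∀ s, 0 < 1 + P s := fun s => by have := hP0 s; positivity
  set w : ℝ → ℝ := fun s => D s / (1 + P s) ^ ((4 : ℝ) / 3) with hw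
  have hw0 : ∀ s, 0 ≤ w s := fun s => div_nonneg (hD0 s) (Real.rpow_nonneg (h1P s).le _)
  set a : ℝ → ℝ := fun s => w s ^ β with ha
  set b : ℝ → ℝ := fun s => (1 + P s) ^ ((3 * m - 1) / (6 * (2 * m - 1))) with hb
  have ha0 : ∀ s, 0 ≤ a s := fun s => Real.rpow_nonneg (hw0 s) _
  have hb0 : ∀ s, 0 ≤ b s := fun s => Real.rpow_nonneg (h1P s).le _
  set L : ℝ → ℝ := fun s => (∫ x,
    (∑ j, ∑ i, ‖Torus.partialDeriv i (Torus.partialDeriv j (u s)) x‖ ^ 2) ^ m) ^ e with hL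
  have hF0 : ∀ s, 0 ≤ ∫ x,
      (∑ j, ∑ i, ‖Torus.partialDeriv i (Torus.partialDeriv j (u s)) x‖ ^ 2) ^ m := fun s =>
    integral_nonneg fun x => Real.rpow_nonneg
      (Finset.sum_nonneg fun j _ => Finset.sum_nonneg fun i _ => sq_nonneg _) _
  have hpt : ∀ s ∈ Icc 0 T, L s ≤ K * (a s * b s) := by
    intro s hs
    have hus : Torus.IsSmooth (u s) := h.smooth_velocity.isSmooth_slice hs
    have hQ : 0 < (1 + P s) ^ ((4 : ℝ) / 3) := Real.rpow_pos_of_pos (h1P s) _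
    have h1 : ∫ x, (∑ j, ∑ i, ‖Torus.partialDeriv i (Torus.partialDeriv j (u s)) x‖ ^ 2) ^ m ≤
        C ^ ((m - 1) / 2) * P s ^ ((3 - m) / 2) * D s ^ (3 * (m - 1) / 2) :=
      Torus.integral_hessSq_rpow_le_of_cube_le hm1 hm3 hus hC0 (hC (u s) hus)
    have h2 := Real.rpow_le_rpow (hF0 s) h1 he0.le
    refine h2.trans ?_
    rw [Real.mul_rpow (mul_nonneg (Real.rpow_nonneg hC0 _) (Real.rpow_nonneg (hP0 s) _))
        (Real.rpow_nonneg (hD0 s) _),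
      Real.mul_rpow (Real.rpow_nonneg hC0 _) (Real.rpow_nonneg (hP0 s) _),
      ← Real.rpow_mul hC0, ← hK, ← Real.rpow_mul (hP0 s), ← Real.rpow_mul (hD0 s)]
    have xβ : 3 * (m - 1) / 2 * e = β := by
      rw [hβ, he, h63]; field_simp
    rw [xβ]
    have hθ0 : 0 ≤ (3 - m) / 2 * e := by
      have : 0 ≤ 3 - m := by linarith
      positivity
    have hP1 : P s ^ ((3 - m) / 2 * e) ≤ (1 + P s) ^ ((3 - m) / 2 * e) :=
      Real.rpow_le_rpow (hP0 s) (by linarith) hθ0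
    have eD : D s ^ β = a s * (1 + P s) ^ ((4 : ℝ) / 3 * β) := by
      have e1 : D s = w s * (1 + P s) ^ ((4 : ℝ) / 3) := by
        rw [hw]; simp only; rw [div_mul_cancel₀ _ hQ.ne']
      show _ = w s ^ β * (1 + P s) ^ ((4 : ℝ) / 3 * β)
      rw [e1, Real.mul_rpow (hw0 s) hQ.le, ← Real.rpow_mul (h1P s).le]
    have eb : (1 + P s) ^ ((3 - m) / 2 * e) * (1 + P s) ^ ((4 : ℝ) / 3 * β) = b s := by
      show _ = (1 + P s) ^ ((3 * m - 1) / (6 * (2 * m - 1)))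
      rw [← Real.rpow_add (h1P s)]
      congr 1
      rw [hβ, he, h63]; field_simp; ring
    calc K * P s ^ ((3 - m) / 2 * e) * D s ^ β
        ≤ K * (1 + P s) ^ ((3 - m) / 2 * e) * D s ^ β :=
          mul_le_mul_of_nonneg_right (mul_le_mul_of_nonneg_left hP1 hK0) (Real.rpow_nonneg (hD0 s) _)
      _ = K * (a s * ((1 + P s) ^ ((3 - m) / 2 * e) * (1 + P s) ^ ((4 : ℝ) / 3 * β))) := by
          rw [eD]; ring
      _ = K * (a s * b s) := by rw [eb]
  -- continuity
  obtain ⟨-, -, hPc, hDc⟩ := continuousOn_four hT h (le_refl (0 : ℝ))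
  have hFc := continuousOn_integral_hessSq_rpow hT h (by linarith : (0 : ℝ) ≤ m)
  have h1Pc : ContinuousOn (fun s => 1 + P s) (Icc 0 T) := continuousOn_const.add hPc
  have hwc : ContinuousOn w (Icc 0 T) :=
    hDc.div (h1Pc.rpow_const fun s _ => Or.inl (h1P s).ne')
      fun s _ => (Real.rpow_pos_of_pos (h1P s) _).ne'
  have hac : ContinuousOn a (Icc 0 T) := hwc.rpow_const fun s _ => Or.inr hβ0.le
  have hbc : ContinuousOn b (Icc 0 T) := h1Pc.rpow_const fun s _ => Or.inl (h1P s).ne'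
  have hLc : ContinuousOn L (Icc 0 T) := hFc.rpow_const fun s _ => Or.inr he0.le
  -- Hölder in time
  set p₁ : ℝ := 2 * (2 * m - 1) / (m - 1) with hp₁
  set q₁ : ℝ := 2 * (2 * m - 1) / (3 * m - 1) with hq₁
  have hpq : p₁.HolderConjugate q₁ := by
    refine Real.holderConjugate_iff.2 ⟨?_, ?_⟩
    · rw [hp₁, lt_div_iff₀ hm1']; linarith
    · rw [hp₁, hq₁]; field_simp; ring
  set μ : Measure ℝ := volume.restrict (Ioc 0 T) with hμ
  haveI : IsFiniteMeasure μ := by rw [hμ]; infer_instance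
  have hmemLp : ∀ {g : ℝ → ℝ}, ContinuousOn g (Icc 0 T) → ∀ r : ℝ≥0∞, MemLp g r μ := by
    intro g hg r
    obtain ⟨C', hC'⟩ := isCompact_Icc.exists_bound_of_continuousOn hg
    have hmeas : AEStronglyMeasurable g μ :=
      (hg.mono Ioc_subset_Icc_self).aestronglyMeasurable measurableSet_Ioc
    refine MemLp.of_bound hmeas C' ?_
    rw [hμ, ae_restrict_iff' measurableSet_Ioc]
    exact ae_of_all _ fun s hs => hC' s (Ioc_subset_Icc_self hs)
  have hH := integral_mul_le_Lp_mul_Lq_of_nonneg (μ := μ) hpq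
    (ae_of_all _ fun s => ha0 s) (ae_of_all _ fun s => hb0 s) (hmemLp hac _) (hmemLp hbc _)
  have hap : ∀ s, a s ^ p₁ = w s := fun s => by
    rw [ha]; simp only; rw [← Real.rpow_mul (hw0 s)]
    have : β * p₁ = 1 := by
      rw [hβ, hp₁, div_mul_div_comm, div_eq_one_iff_eq (by positivity)]; ring
    rw [this, Real.rpow_one]
  have hbq : ∀ s, b s ^ q₁ = (1 + P s) ^ ((1 : ℝ) / 3) := fun s => by
    rw [hb]; simp only; rw [← Real.rpow_mul (h1P s).le]
    congr 1
    rw [hq₁, div_mul_div_comm, div_eq_div_iff (by positivity) (by norm_num)]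
    ring
  have hI2 : ∫ s, a s ^ p₁ ∂μ = ∫ t in (0 : ℝ)..T, w t := by
    rw [intervalIntegral.integral_of_le hT.le, hμ]
    exact integral_congr_ae (ae_of_all _ fun s => hap s)
  have hI3 : ∫ s, b s ^ q₁ ∂μ = ∫ t in (0 : ℝ)..T, (1 + P t) ^ ((1 : ℝ) / 3) := by
    rw [intervalIntegral.integral_of_le hT.le, hμ]
    exact integral_congr_ae (ae_of_all _ fun s => hbq s)
  rw [hI2, hI3] at hH
  -- budgets
  have hA : ∫ t in (0 : ℝ)..T, w t ≤ W / ν := by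
    rw [le_div_iff₀ hν, mul_comm]
    have := Torus.classicalNS_integral_gradNormSq_laplacian_div_le hd hν hT h hmean
    simpa [hW, hB₂] using this
  have hB : ∫ t in (0 : ℝ)..T, (1 + P t) ^ ((1 : ℝ) / 3) ≤ T + B₂ := by
    have h13 : ∀ t, (1 + P t) ^ ((1 : ℝ) / 3) ≤ 1 + P t ^ ((1 : ℝ) / 3) := fun t => by
      have := Real.rpow_add_le_add_rpow zero_le_one (hP0 t) (by norm_num : (0 : ℝ) ≤ 1 / 3)
        (by norm_num)
      simpa using this
    have hP13c : ContinuousOn (fun s => P s ^ ((1 : ℝ) / 3)) (Icc 0 T) :=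
      hPc.rpow_const fun s _ => Or.inr (by norm_num)
    have hP13i : IntervalIntegrable (fun s => P s ^ ((1 : ℝ) / 3)) volume 0 T :=
      (hP13c.mono (by rw [uIcc_of_le hT.le])).intervalIntegrable
    have hmono : ∫ t in (0 : ℝ)..T, (1 + P t) ^ ((1 : ℝ) / 3) ≤
        ∫ t in (0 : ℝ)..T, (1 + P t ^ ((1 : ℝ) / 3)) := by
      refine intervalIntegral.integral_mono_on hT.le ?_ (intervalIntegrable_const.add hP13i)
        fun t _ => h13 t
      exact ((h1Pc.rpow_const fun s _ => Or.inl (h1P s).ne').mono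
        (by rw [uIcc_of_le hT.le])).intervalIntegrable
    rw [intervalIntegral.integral_add intervalIntegrable_const hP13i, intervalIntegral.integral_const,
      smul_eq_mul, sub_zero, mul_one] at hmono
    have hE := Torus.classicalNS_integral_laplacian_twoThirds_le hd hν hT h hmean
    rw [← hB₂] at hE
    linarith
  have hA0 : 0 ≤ ∫ t in (0 : ℝ)..T, w t := intervalIntegral.integral_nonneg hT.le fun s _ => hw0 s
  have hB0' : 0 ≤ ∫ t in (0 : ℝ)..T, (1 + P t) ^ ((1 : ℝ) / 3) :=
    intervalIntegral.integral_nonneg hT.le fun s _ => Real.rpow_nonneg (h1P s).le _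
  have x1p : 1 / p₁ = β := by rw [hp₁, hβ, one_div_div]
  have x1q : 1 / q₁ = γ := by rw [hq₁, hγ, one_div_div]
  have hH' : ∫ s, a s * b s ∂μ ≤ (W / ν) ^ β * (T + B₂) ^ γ := by
    refine hH.trans ?_
    rw [x1p, x1q]
    exact mul_le_mul (Real.rpow_le_rpow hA0 hA hβ0.le) (Real.rpow_le_rpow hB0' hB hγ0.le)
      (Real.rpow_nonneg hB0' _) (Real.rpow_nonneg (hA0.trans hA) _)
  have hmono : ∫ t in (0 : ℝ)..T, L t ≤ ∫ t in (0 : ℝ)..T, K * (a t * b t) := by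
    refine intervalIntegral.integral_mono_on hT.le ?_ ?_ hpt
    · exact (hLc.mono (by rw [uIcc_of_le hT.le])).intervalIntegrable
    · exact ((continuousOn_const.mul (hac.mul hbc)).mono (by rw [uIcc_of_le hT.le])).intervalIntegrable
  have hI1 : ∫ t in (0 : ℝ)..T, K * (a t * b t) = K * ∫ s, a s * b s ∂μ := by
    rw [intervalIntegral.integral_const_mul, intervalIntegral.integral_of_le hT.le, hμ]
  calc ∫ t in (0 : ℝ)..T, L t ≤ K * ∫ s, a s * b s ∂μ := hmono.trans (le_of_eq hI1)
    _ ≤ K * ((W / ν) ^ β * (T + B₂) ^ γ) := mul_le_mul_of_nonneg_left hH' hK0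
    _ = K * (W / ν) ^ β * (T + B₂) ^ γ := by ring

/-- **The square `(2, 3)`: `∫₀ᵀ ‖∇²u‖_{L⁶}^{2/5} dt` bounded a priori on `T³`** (plain Sobolev for
the Hessian and the `H³` square `(3,1)` `∫₀ᵀ‖∇Δu‖₂^{2/5} ≤ (W₃/ν)^{1/5}(T+B₂)^{4/5}`): there is
`K ≥ 0` (`= C^{1/15}`, `C` the Hessian Sobolev constant) with
`∫₀ᵀ (∫(∑ⱼᵢ‖∂ᵢ∂ⱼu(t)‖²)³)^{1/15} dt ≤ K (W₃/ν)^{1/5} (T + B₂)^{4/5}` along every classical mean-zero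
solution on `[0, T] × T^d`, `card d = 3` (`α_{2,3} = 2/5`).
[cite: Gibbon2019Chessboard, Theorem 2 (i) (n = 2, m = 3), Appendix A §5.1]
[cite: FoiasGuillopeTemam1981, Thm 3.1] -/
theorem Torus.exists_classicalNS_integral_hessL6_fifteenth_le (hd : Fintype.card d = 3) :
    ∃ K : ℝ, 0 ≤ K ∧ ∀ {ν T : ℝ}, 0 < ν → 0 < T →
      ∀ {u : ℝ → UnitAddTorus d → EuclideanSpace ℝ d} {p : ℝ → UnitAddTorus d → ℝ},
        Torus.IsClassicalNSSolutionOn (Icc 0 T) ν 0 u p →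
        (∀ t ∈ Icc 0 T, Torus.HasZeroMean (u t)) →
        ∫ t in (0 : ℝ)..T, (∫ x,
            (∑ j, ∑ i, ‖Torus.partialDeriv i (Torus.partialDeriv j (u t)) x‖ ^ 2) ^ 3) ^
              ((1 : ℝ) / 15) ≤
          K * (((3 + 3 / 2 * (3 * Real.sqrt 2 / π) ^ ((4 : ℝ) / 3) * (2 * ν) ^ (-(1 : ℝ) / 3) *
              ((1 / ν + 27 * (∫ x, ‖u 0 x‖ ^ 2) / (8 * π ^ 4 * ν ^ 5)) ^ ((1 : ℝ) / 3) *
                (T + (∫ x, ‖u 0 x‖ ^ 2) / (2 * ν)) ^ ((2 : ℝ) / 3))) / ν) ^ ((1 : ℝ) / 5) *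
            (T + (1 / ν + 27 * (∫ x, ‖u 0 x‖ ^ 2) / (8 * π ^ 4 * ν ^ 5)) ^ ((1 : ℝ) / 3) *
              (T + (∫ x, ‖u 0 x‖ ^ 2) / (2 * ν)) ^ ((2 : ℝ) / 3)) ^ ((4 : ℝ) / 5)) := by
  obtain ⟨C, hC0, hC⟩ := Torus.exists_integral_hessSq_cube_le_gradNormSq_laplacian_cube (d := d) hd
  refine ⟨C ^ ((1 : ℝ) / 15), Real.rpow_nonneg hC0 _, ?_⟩
  intro ν T hν hT u p h hmean
  set D : ℝ → ℝ := fun s => Torus.gradNormSq (Torus.laplacian (u s)) with hDdef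
  have hD0 : ∀ s, 0 ≤ D s := fun s => Torus.gradNormSq_nonneg _
  set L : ℝ → ℝ := fun s => (∫ x,
    (∑ j, ∑ i, ‖Torus.partialDeriv i (Torus.partialDeriv j (u s)) x‖ ^ 2) ^ 3) ^ ((1 : ℝ) / 15)
    with hL
  have hF0 : ∀ s, 0 ≤ ∫ x,
      (∑ j, ∑ i, ‖Torus.partialDeriv i (Torus.partialDeriv j (u s)) x‖ ^ 2) ^ 3 := fun s =>
    integral_nonneg fun x => pow_nonneg
      (Finset.sum_nonneg fun j _ => Finset.sum_nonneg fun i _ => sq_nonneg _) 3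
  have hpt : ∀ s ∈ Icc 0 T, L s ≤ C ^ ((1 : ℝ) / 15) * D s ^ ((1 : ℝ) / 5) := by
    intro s hs
    have hus : Torus.IsSmooth (u s) := h.smooth_velocity.isSmooth_slice hs
    have h1 := hC (u s) hus
    have h2 := Real.rpow_le_rpow (hF0 s) h1 (by norm_num : (0 : ℝ) ≤ 1 / 15)
    refine h2.trans (le_of_eq ?_)
    rw [Real.mul_rpow hC0 (pow_nonneg (hD0 s) 3), show (D s ^ 3 : ℝ) = D s ^ (3 : ℝ) by norm_cast,
      ← Real.rpow_mul (hD0 s)]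
    norm_num
  -- continuity
  obtain ⟨-, -, -, hDc⟩ := continuousOn_four hT h (le_refl (0 : ℝ))
  have hLc : ContinuousOn L (Icc 0 T) := by
    have h3 := continuousOn_integral_hessSq_rpow hT h (by norm_num : (0 : ℝ) ≤ 3)
    have h3' : ContinuousOn (fun s => ∫ x,
        (∑ j, ∑ i, ‖Torus.partialDeriv i (Torus.partialDeriv j (u s)) x‖ ^ 2) ^ 3) (Icc 0 T) := by
      refine h3.congr fun s _ => integral_congr_ae (ae_of_all _ fun x => ?_)
      simp only
      exact_mod_cast (Real.rpow_natCast _ 3).symm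
    exact h3'.rpow_const fun s _ => Or.inr (by norm_num)
  have hRc : ContinuousOn (fun s => C ^ ((1 : ℝ) / 15) * D s ^ ((1 : ℝ) / 5)) (Icc 0 T) :=
    continuousOn_const.mul (hDc.rpow_const fun s _ => Or.inr (by norm_num))
  have hmono : ∫ t in (0 : ℝ)..T, L t ≤ ∫ t in (0 : ℝ)..T, C ^ ((1 : ℝ) / 15) * D t ^ ((1 : ℝ) / 5) := by
    refine intervalIntegral.integral_mono_on hT.le ?_ ?_ hpt
    · exact (hLc.mono (by rw [uIcc_of_le hT.le])).intervalIntegrable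
    · exact (hRc.mono (by rw [uIcc_of_le hT.le])).intervalIntegrable
  rw [intervalIntegral.integral_const_mul] at hmono
  have hA := Torus.classicalNS_integral_gradNormSq_laplacian_fifth_le hd hν hT h hmean
  calc ∫ t in (0 : ℝ)..T, L t ≤ C ^ ((1 : ℝ) / 15) * ∫ t in (0 : ℝ)..T, D t ^ ((1 : ℝ) / 5) := hmono
    _ ≤ _ := mul_le_mul_of_nonneg_left hA (Real.rpow_nonneg hC0 _)

end Literature.Analysis.FluidPDE

end
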